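import Summits.SmoothPoincare4.SmoothPoincare4.Theorems.SymplecticOrigamiGromovRecognitionRelEndHelperPlanarIndexZeroExtension
import Literature.Topology.FourManifolds.ProjectiveLineRotationField
import Literature.Topology.PlaneTopology.WindingNumber

/-!
# An oriented plane field of Euler number zero over the Riemann sphere has a nowhere-zero section
(registered helper `helper_sphereSectionOfIndexZero` of the stub `stub_normalWitnessTransfer`,
line `cross-cap-laurent`, crux `GromovRecognitionRelEnd`, item stmt-SmoothPoincare4-11009)

Setting.  Over `ℂℙ¹` (`ComplexProjectiveSpace 1`, affinely parametrised by
`linePt 0 z = [1 : z]`, `ProjectiveLineRotationField.lean`) we are given an *oriented plane field*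
in the fixed space `F = ℝᵐ × ℝ²`: continuous families of idempotents `P θ` and of quarter-turn
rotations `R θ` of the planes `range (P θ)`, orthogonal for the pairing
`B x y = ⟪x.1, y.1⟫ + ⟪x.2, y.2⟫`, together with
* a continuous nowhere-zero section `s` of the field off the finite crossing set `linePt 0 '' Z`,
  `Z` inside the chart disc `‖z‖ < R₀`;
* a continuous frame vector `t` of the field over the closed chart disc `‖z‖ ≤ R₁`, `R₀ < R₁`;
* the complex coordinate `φ z = B(s, t) + i B(s, R t)` of `s` in the frame `(t, R t)`, whose
  winding numbers about the punctures add up to `0`.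
Claim (`helper_sphereSectionOfIndexZero`): the plane field has a global continuous nowhere-zero
section ("Euler number `0` ⇒ the oriented plane bundle over `S²` has a section", the clutching
description of plane bundles over the `2`-sphere, N. Steenrod, *The Topology of Fibre Bundles*
(1951), §18 and §26; J. Milnor, J. Stasheff, *Characteristic Classes* (1974), §9, §14).

Proof.  (1) `φ` is continuous and zero-free on the punctured closed disc (`s = 0·t + 0·Rt` would
follow from `φ z = 0` by the span axiom).  (2) The landed helper
`helper_planarIndexZeroExtension` (argument principle, Hatcher §1.1) replaces `φ` by `ψ`,
continuous and zero-free on the whole closed disc and equal to `φ` on the collar `R₀ ≤ ‖z‖`.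
(3) Reconstruct `σ z = (Re ψ / B(t,t)) • t + (Im ψ / B(t,t)) • R t` over the closed disc: it is a
continuous nowhere-zero section there (its frame coordinates are `(Re ψ, Im ψ)`,
`HelperSphereSectionOfIndexZero.pairing_combo_fst/snd`) and agrees with `s ∘ linePt 0` on the
collar (span axiom).  (4) Glue `σ` (on the compact image `linePt 0 '' closedBall 0 R₁`) with `s`
(outside) by the pasting lemma `continuous_piecewise`; the two pieces agree on the frontier, which
lies over the circle `‖z‖ = R₁` because the image of the open disc is open in `ℂℙ¹`.

References: N. Steenrod, *The Topology of Fibre Bundles*, PUP (1951), §18, §26 [Steenrod1951];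
A. Hatcher, *Algebraic Topology*, CUP (2002), §1.1 [HatcherAT2002]; P. Griffiths, J. Harris,
*Principles of Algebraic Geometry* (1978), Ch. 0 §2 [GriffithsHarrisPrinciples1978].
No new definitions.
-/

noncomputable section

open Set Metric Filter Literature.Topology.PlaneTopology
open Literature.Topology.FourManifolds Literature.Topology.FourManifolds.ComplexProjectiveSpace
  Literature.Topology.FourManifolds.CodimTwoData
open scoped Topology Real Manifold ContDiff

-- the prescribed namespace `Summit.<P>.<Sub>.…` duplicates `SmoothPoincare4` (P = Sub)
set_option linter.dupNamespace false

namespace Summit.SmoothPoincare4.SmoothPoincare4.Theorems.GromovRecognitionRelEnd.CrossCapLaurent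

namespace HelperSphereSectionOfIndexZero

section Pairing

variable {E₁ E₂ : Type*} [NormedAddCommGroup E₁] [InnerProductSpace ℝ E₁] [NormedAddCommGroup E₂]
  [InnerProductSpace ℝ E₂]

/-- The pairing `B v v = ⟪v.1, v.1⟫ + ⟪v.2, v.2⟫` of a nonzero vector of `E₁ × E₂` with itself is
positive. [folklore] -/
theorem pairing_self_pos {v : E₁ × E₂} (hv : v ≠ 0) : 0 < inner ℝ v.1 v.1 + inner ℝ v.2 v.2 := by
  by_contra h
  have h0 := not_lt.1 h
  have h1 : inner ℝ v.1 v.1 = 0 :=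
    le_antisymm (by linarith [real_inner_self_nonneg (x := v.2)]) real_inner_self_nonneg
  have h2 : inner ℝ v.2 v.2 = 0 :=
    le_antisymm (by linarith [real_inner_self_nonneg (x := v.1)]) real_inner_self_nonneg
  exact hv (Prod.ext (inner_self_eq_zero.1 h1) (inner_self_eq_zero.1 h2))

/-- First frame coordinate: if `B w v = 0` then `B (a • v + b • w) v = a · B v v`. [folklore] -/
theorem pairing_combo_fst {v w : E₁ × E₂} (hwv : inner ℝ w.1 v.1 + inner ℝ w.2 v.2 = 0)
    (a b : ℝ) :
    inner ℝ (a • v + b • w).1 v.1 + inner ℝ (a • v + b • w).2 v.2 =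
      a * (inner ℝ v.1 v.1 + inner ℝ v.2 v.2) := by
  simp only [Prod.fst_add, Prod.snd_add, Prod.smul_fst, Prod.smul_snd, inner_add_left,
    real_inner_smul_left]
  linear_combination b * hwv

/-- Second frame coordinate: if `B w v = 0` and `B w w = B v v` then
`B (a • v + b • w) w = b · B v v`. [folklore] -/
theorem pairing_combo_snd {v w : E₁ × E₂} (hwv : inner ℝ w.1 v.1 + inner ℝ w.2 v.2 = 0)
    (hww : inner ℝ w.1 w.1 + inner ℝ w.2 w.2 = inner ℝ v.1 v.1 + inner ℝ v.2 v.2) (a b : ℝ) :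
    inner ℝ (a • v + b • w).1 w.1 + inner ℝ (a • v + b • w).2 w.2 =
      b * (inner ℝ v.1 v.1 + inner ℝ v.2 v.2) := by
  simp only [Prod.fst_add, Prod.snd_add, Prod.smul_fst, Prod.smul_snd, inner_add_left,
    real_inner_smul_left]
  rw [real_inner_comm v.1 w.1, real_inner_comm v.2 w.2] at hwv
  linear_combination a * hwv + b * hww

/-- A frame combination `a • v + b • w` (`B w v = 0`, `B w w = B v v`, `v ≠ 0`) vanishes only if
both coefficients vanish. [folklore] -/
theorem eq_zero_of_combo_eq_zero {v w : E₁ × E₂} (hv : v ≠ 0)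
    (hwv : inner ℝ w.1 v.1 + inner ℝ w.2 v.2 = 0)
    (hww : inner ℝ w.1 w.1 + inner ℝ w.2 w.2 = inner ℝ v.1 v.1 + inner ℝ v.2 v.2) {a b : ℝ}
    (h : a • v + b • w = 0) : a = 0 ∧ b = 0 := by
  have hB := pairing_self_pos hv
  have ha := pairing_combo_fst hwv a b
  have hb := pairing_combo_snd hwv hww a b
  rw [h] at ha hb
  simp only [Prod.fst_zero, Prod.snd_zero, inner_zero_left, add_zero] at ha hb
  exact ⟨(mul_eq_zero.1 ha.symm).resolve_right hB.ne', (mul_eq_zero.1 hb.symm).resolve_right hB.ne'⟩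

end Pairing

/-- The affine parametrisation `linePt i` of `ℂℙ¹` is injective (it has the left inverse
`affineCoordComplex i · 0`). [cite: GriffithsHarrisPrinciples1978, Ch. 0 §2] -/
theorem linePt_injective (i : Fin 2) : Function.Injective (linePt i) := fun z z' h => by
  rw [← affineCoordComplex_linePt i z, h, affineCoordComplex_linePt]

/-- The sub-level set `{θ | θ₀ ≠ 0 ∧ ‖z₀(θ)‖ < ρ}` of the affine coordinate is open in `ℂℙ¹`
and contained in the image `linePt 0 '' closedBall 0 ρ` of the closed chart disc. [folklore] -/
theorem isOpen_chartBall (ρ : ℝ) :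
    IsOpen ({θ : ComplexProjectiveSpace 1 | CoordNeZero 0 θ} ∩
      (fun θ => affineCoordComplex 0 θ 0) ⁻¹' ball (0 : ℂ) ρ) ∧
    {θ : ComplexProjectiveSpace 1 | CoordNeZero 0 θ} ∩
      (fun θ => affineCoordComplex 0 θ 0) ⁻¹' ball (0 : ℂ) ρ ⊆ linePt 0 '' closedBall (0 : ℂ) ρ := by
  refine ⟨(Literature.Geometry.Symplectic.contMDiffOn_affineCoordComplex 0).continuousOn
    |>.isOpen_inter_preimage (isOpen_setOf_coordNeZero 0) isOpen_ball, ?_⟩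
  rintro θ ⟨h1, h2⟩
  exact ⟨_, ball_subset_closedBall h2, linePt_affineCoordComplex h1⟩

end HelperSphereSectionOfIndexZero

open HelperSphereSectionOfIndexZero

/-- **Registered helper `helper_sphereSectionOfIndexZero`: an oriented plane field over `ℂℙ¹`
whose section `s` (defined off finitely many crossings in a chart disc) has total index `0` with
respect to a frame `t` over that disc admits a global continuous nowhere-zero section.**
Extend the frame coordinate `φ = B(s,t) + i B(s,Rt)` across the punctures
(`helper_planarIndexZeroExtension`), rebuild a section `σ` over the closed disc from the extended
coordinate, and glue it with `s` along the circle `‖z‖ = R₁` (`continuous_piecewise`).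
[cite: Steenrod1951, §26] -/
theorem helper_sphereSectionOfIndexZero : ∀ (m : ℕ) (P R : Literature.Topology.FourManifolds.ComplexProjectiveSpace 1 → (EuclideanSpace ℝ (Fin m) × EuclideanSpace ℝ (Fin 2)) →L[ℝ] (EuclideanSpace ℝ (Fin m) × EuclideanSpace ℝ (Fin 2))) (s : Literature.Topology.FourManifolds.ComplexProjectiveSpace 1 → EuclideanSpace ℝ (Fin m) × EuclideanSpace ℝ (Fin 2)) (t : ℂ → EuclideanSpace ℝ (Fin m) × EuclideanSpace ℝ (Fin 2)) (φ : ℂ → ℂ) (Z : Finset ℂ) (R₀ R₁ r : ℝ), Continuous P → Continuous R → (∀ θ, (∀ v, P θ (P θ v) = P θ v) ∧ (∀ v, P θ (R θ v) = R θ v) ∧ (∀ v, R θ (P θ v) = R θ v) ∧ (∀ v, R θ (R θ v) = - P θ v) ∧ (∀ v, inner ℝ (R θ v).1 (P θ v).1 + inner ℝ (R θ v).2 (P θ v).2 = 0) ∧ (∀ v, inner ℝ (R θ v).1 (R θ v).1 + inner ℝ (R θ v).2 (R θ v).2 = inner ℝ (P θ v).1 (P θ v).1 + inner ℝ (P θ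 v).2 (P θ v).2) ∧ P θ ≠ 0 ∧ (∀ v w', P θ v = v → v ≠ 0 → P θ w' = w' → w' = ((inner ℝ w'.1 v.1 + inner ℝ w'.2 v.2) / (inner ℝ v.1 v.1 + inner ℝ v.2 v.2)) • v + ((inner ℝ w'.1 (R θ v).1 + inner ℝ w'.2 (R θ v).2) / (inner ℝ v.1 v.1 + inner ℝ v.2 v.2)) • R θ v)) → 0 < R₀ → R₀ < R₁ → 0 < r → (∀ ζ ∈ Z, ‖ζ‖ + r < R₀) → (∀ ζ ∈ Z, ∀ ζ' ∈ Z, ζ ≠ ζ' → 2 * r < ‖ζ - ζ'‖) → ContinuousOn s {θ | θ ∉ Literature.Topology.FourManifolds.CodimTwoData.linePt 0 '' (↑Z : Set ℂ)} → (∀ θ, θ ∉ Literature.Topology.FourManifolds.CodimTwoData.linePt 0 '' (↑Z : Set ℂ) → P θ (s θ) = s θ ∧ s θ ≠ 0) → ContinuousOn t (Metric.closedBall 0 R₁) → (∀ z ∈ Metric.closedBall (0 : ℂ) R₁, P (Literature.Topology.FourManifolds.CodimTwoData.linePt 0 z) (t z) = t z ∧ t z ≠ 0) → (∀ z, φ z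 = ((inner ℝ (s (Literature.Topology.FourManifolds.CodimTwoData.linePt 0 z)).1 (t z).1 + inner ℝ (s (Literature.Topology.FourManifolds.CodimTwoData.linePt 0 z)).2 (t z).2 : ℝ) : ℂ) + ((inner ℝ (s (Literature.Topology.FourManifolds.CodimTwoData.linePt 0 z)).1 (R (Literature.Topology.FourManifolds.CodimTwoData.linePt 0 z) (t z)).1 + inner ℝ (s (Literature.Topology.FourManifolds.CodimTwoData.linePt 0 z)).2 (R (Literature.Topology.FourManifolds.CodimTwoData.linePt 0 z) (t z)).2 : ℝ) : ℂ) * Complex.I) → ∑ ζ ∈ Z, Literature.Topology.PlaneTopology.wind (fun τ => φ (Literature.Topology.PlaneTopology.circleLoop ζ r τ)) = 0 → ∃ s' : Literature.Topology.FourManifolds.ComplexProjectiveSpace 1 → EuclideanSpace ℝ (Fin m) × EuclideanSpace ℝ (Fin 2), Continuous s' ∧ ∀ θ, P θ (s' θ) = s' θ ∧ s' θ ≠ 0 := by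
  classical
  intro m P R s t φ Z R₀ R₁ r _hPc hRc hax hR₀ hR₀₁ hr hZ hsep hsc hs htc ht hφ hsum
  have hZn : ∀ ζ ∈ Z, ‖ζ‖ < R₀ := fun ζ hζ => by linarith [hZ ζ hζ]
  have hre : ∀ x y : ℝ, ((x : ℂ) + (y : ℂ) * Complex.I).re = x := fun x y => by simp
  have him : ∀ x y : ℝ, ((x : ℂ) + (y : ℂ) * Complex.I).im = y := fun x y => by simp
  have hinj : Function.Injective (linePt 0) := linePt_injective 0
  -- points `linePt 0 z` of the collar `R₀ ≤ ‖z‖` are not crossings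
  have hnotZ : ∀ z : ℂ, R₀ ≤ ‖z‖ → linePt 0 z ∉ linePt 0 '' (↑Z : Set ℂ) := fun z hz hmem => by
    have := hZn z (Finset.mem_coe.1 (hinj.mem_set_image.1 hmem))
    linarith
  -- consequences of the axioms at a vector `v` fixed by `P θ`
  have hRv : ∀ θ v, P θ v = v →
      inner ℝ (R θ v).1 v.1 + inner ℝ (R θ v).2 v.2 = 0 ∧
      inner ℝ (R θ v).1 (R θ v).1 + inner ℝ (R θ v).2 (R θ v).2 =
        inner ℝ v.1 v.1 + inner ℝ v.2 v.2 := fun θ v hv => by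
    obtain ⟨-, -, -, -, h5, h6, -, -⟩ := hax θ
    have h5' := h5 v
    have h6' := h6 v
    rw [hv] at h5' h6'
    exact ⟨h5', h6'⟩
  -- Step 1: `φ` is continuous and zero-free on the punctured closed disc
  have hslc : ContinuousOn (fun z : ℂ => s (linePt 0 z)) {z | z ∉ (↑Z : Set ℂ)} :=
    hsc.comp (continuous_linePt 0).continuousOn fun z hz hmem =>
      hz (hinj.mem_set_image.1 hmem)
  have hsub1 : closedBall (0 : ℂ) R₁ \ ↑Z ⊆ {z | z ∉ (↑Z : Set ℂ)} := fun z hz => hz.2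
  have hRtc : ContinuousOn (fun z : ℂ => R (linePt 0 z) (t z)) (closedBall 0 R₁) :=
    (hRc.comp (continuous_linePt 0)).continuousOn.clm_apply htc
  have hφc : ContinuousOn φ (closedBall 0 R₁ \ ↑Z) := by
    have e : φ = fun z => ((inner ℝ (s (linePt 0 z)).1 (t z).1 +
        inner ℝ (s (linePt 0 z)).2 (t z).2 : ℝ) : ℂ) +
        ((inner ℝ (s (linePt 0 z)).1 (R (linePt 0 z) (t z)).1 +
          inner ℝ (s (linePt 0 z)).2 (R (linePt 0 z) (t z)).2 : ℝ) : ℂ) * Complex.I :=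
      funext hφ
    rw [e]
    have hsub2 : closedBall (0 : ℂ) R₁ \ ↑Z ⊆ closedBall (0 : ℂ) R₁ := Set.sdiff_subset
    have hs1 := hslc.mono hsub1
    have ht1 := htc.mono hsub2
    have hRt1 := hRtc.mono hsub2
    refine (Complex.continuous_ofReal.comp_continuousOn
      ((hs1.fst.inner ht1.fst).add (hs1.snd.inner ht1.snd))).add
      ((Complex.continuous_ofReal.comp_continuousOn
        ((hs1.fst.inner hRt1.fst).add (hs1.snd.inner hRt1.snd))).mul continuousOn_const)
  have hφ0 : ∀ z ∈ closedBall (0 : ℂ) R₁ \ ↑Z, φ z ≠ 0 := by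
    rintro z ⟨hzB, hzZ⟩ h0
    have hθ : linePt 0 z ∉ linePt 0 '' (↑Z : Set ℂ) := fun hmem => hzZ (hinj.mem_set_image.1 hmem)
    obtain ⟨hPs, hs0⟩ := hs _ hθ
    obtain ⟨hPt, ht0⟩ := ht z hzB
    have hspan := (hax (linePt 0 z)).2.2.2.2.2.2.2 (t z) (s (linePt 0 z)) hPt ht0 hPs
    have hre0 := congrArg Complex.re (hφ z)
    have him0 := congrArg Complex.im (hφ z)
    rw [h0, hre] at hre0
    rw [h0, him] at him0
    rw [← hre0, ← him0, Complex.zero_re, Complex.zero_im, zero_div, zero_smul, zero_smul,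
      add_zero] at hspan
    exact hs0 hspan
  -- Step 2: extend the frame coordinate across the punctures
  obtain ⟨ψ, hψc, hψ0, hψφ⟩ :=
    helper_planarIndexZeroExtension φ Z R₀ R₁ r hR₀ hR₀₁ hr hZ hsep hφc hφ0 hsum
  -- Step 3: rebuild a section over the closed chart disc from the extended coordinate
  obtain ⟨σ, hσ⟩ : ∃ σ : ℂ → EuclideanSpace ℝ (Fin m) × EuclideanSpace ℝ (Fin 2), ∀ z, σ z =
      ((ψ z).re / (inner ℝ (t z).1 (t z).1 + inner ℝ (t z).2 (t z).2)) • t z +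
      ((ψ z).im / (inner ℝ (t z).1 (t z).1 + inner ℝ (t z).2 (t z).2)) • R (linePt 0 z) (t z) :=
    ⟨_, fun _ => rfl⟩
  have hBt0 : ∀ z ∈ closedBall (0 : ℂ) R₁, inner ℝ (t z).1 (t z).1 + inner ℝ (t z).2 (t z).2 ≠ 0 :=
    fun z hz => (pairing_self_pos (ht z hz).2).ne'
  have hσc : ContinuousOn σ (closedBall 0 R₁) := by
    rw [show σ = _ from funext hσ]
    have hBc : ContinuousOn (fun z => inner ℝ (t z).1 (t z).1 + inner ℝ (t z).2 (t z).2)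
        (closedBall 0 R₁) := (htc.fst.inner htc.fst).add (htc.snd.inner htc.snd)
    exact (((Complex.continuous_re.comp_continuousOn hψc).div hBc hBt0).smul htc).add
      (((Complex.continuous_im.comp_continuousOn hψc).div hBc hBt0).smul hRtc)
  have hσP : ∀ z ∈ closedBall (0 : ℂ) R₁, P (linePt 0 z) (σ z) = σ z := fun z hz => by
    rw [hσ z, map_add, map_smul, map_smul, (ht z hz).1, (hax (linePt 0 z)).2.1]
  have hσ0 : ∀ z ∈ closedBall (0 : ℂ) R₁, σ z ≠ 0 := fun z hz h0 => by
    obtain ⟨hPt, ht0⟩ := ht z hz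
    obtain ⟨hwv, hww⟩ := hRv _ _ hPt
    rw [hσ z] at h0
    obtain ⟨ha, hb⟩ := eq_zero_of_combo_eq_zero ht0 hwv hww h0
    have hB := hBt0 z hz
    rw [div_eq_zero_iff, or_iff_left hB] at ha hb
    exact hψ0 z hz (Complex.ext ha hb)
  have hσs : ∀ z ∈ closedBall (0 : ℂ) R₁, R₀ ≤ ‖z‖ → σ z = s (linePt 0 z) := fun z hz hz0 => by
    obtain ⟨hPt, ht0⟩ := ht z hz
    obtain ⟨hPs, -⟩ := hs _ (hnotZ z hz0)
    have hspan := (hax (linePt 0 z)).2.2.2.2.2.2.2 (t z) (s (linePt 0 z)) hPt ht0 hPs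
    rw [hσ z, hψφ z hz0, hφ z, hre, him]
    exact hspan.symm
  -- Step 4: glue `σ` (over the closed chart disc) with `s` (outside)
  set A : Set (ComplexProjectiveSpace 1) := linePt 0 '' closedBall (0 : ℂ) R₁ with hA
  have hAc : IsClosed A := ((isCompact_closedBall (0 : ℂ) R₁).image (continuous_linePt 0)).isClosed
  obtain ⟨hUo, hUA⟩ := isOpen_chartBall R₁
  have hUZ : linePt 0 '' (↑Z : Set ℂ) ⊆ {θ : ComplexProjectiveSpace 1 | CoordNeZero 0 θ} ∩
      (fun θ => affineCoordComplex 0 θ 0) ⁻¹' ball (0 : ℂ) R₁ := by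
    rintro _ ⟨ζ, hζ, rfl⟩
    refine ⟨coordNeZero_linePt 0 ζ, ?_⟩
    show affineCoordComplex 0 (linePt 0 ζ) 0 ∈ ball (0 : ℂ) R₁
    rw [affineCoordComplex_linePt, mem_ball_zero_iff]
    exact (hZn ζ (Finset.mem_coe.1 hζ)).trans hR₀₁
  refine ⟨A.piecewise (fun θ => σ (affineCoordComplex 0 θ 0)) s, ?_, fun θ => ?_⟩
  · refine continuous_piecewise ?_ ?_ ?_
    · -- the two pieces agree on the frontier, which lies over the circle `‖z‖ = R₁`
      rintro θ ⟨hθc, hθi⟩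
      obtain ⟨z, hz, rfl⟩ := hAc.closure_subset hθc
      have hzU := fun h => hθi (interior_maximal hUA hUo h)
      have hz1 : R₁ ≤ ‖z‖ := by
        by_contra hlt
        exact hzU ⟨coordNeZero_linePt 0 z, by
          show affineCoordComplex 0 (linePt 0 z) 0 ∈ ball (0 : ℂ) R₁
          rw [affineCoordComplex_linePt, mem_ball_zero_iff]
          exact not_le.1 hlt⟩
      show σ (affineCoordComplex 0 (linePt 0 z) 0) = s (linePt 0 z)
      rw [affineCoordComplex_linePt]
      exact hσs z hz (hR₀₁.le.trans hz1)
    · rw [hAc.closure_eq]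
      refine hσc.comp
        ((Literature.Geometry.Symplectic.contMDiffOn_affineCoordComplex 0).continuousOn.mono ?_) ?_
      · rintro _ ⟨z, -, rfl⟩
        exact coordNeZero_linePt 0 z
      · rintro _ ⟨z, hz, rfl⟩
        show affineCoordComplex 0 (linePt 0 z) 0 ∈ closedBall (0 : ℂ) R₁
        rwa [affineCoordComplex_linePt]
    · refine hsc.mono ((closure_minimal (compl_subset_compl.2 hUA) hUo.isClosed_compl).trans ?_)
      exact fun θ hθ hmem => hθ (hUZ hmem)
  · by_cases hθ : θ ∈ A
    · rw [piecewise_eq_of_mem _ _ _ hθ]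
      obtain ⟨z, hz, rfl⟩ := hθ
      rw [affineCoordComplex_linePt]
      exact ⟨hσP z hz, hσ0 z hz⟩
    · rw [piecewise_eq_of_notMem _ _ _ hθ]
      exact hs θ fun hmem => hθ (hUA (hUZ hmem))

end Summit.SmoothPoincare4.SmoothPoincare4.Theorems.GromovRecognitionRelEnd.CrossCapLaurent

end
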